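import Literature.Computability.Cryptography.DihedralCosetProblem
import Literature.Computability.Cryptography.QuantumCircuitProofs
import HarnessLib

/-!
# Regev's dihedral coset problem — discharged facts

Proofs of named facts stated in `Literature.Computability.Cryptography.DihedralCosetProblem`
(kept in a sibling file so that the statement file stays a definitions/named-facts file):

* `DCP.normSq_inputState_holds` discharges `DCP.normSq_inputState`: the closed-form product
  input state `DCP.inputState m N r d ρ` of a DCP instance (prefix `encodeNat N`, `r` registers
  each in a coset state `(|0, x⟩ + |1, (x + d) mod N⟩)/√2` or a bad basis state `|b, x⟩`,
  zero workspace) is a unit vector as soon as `len N + r * (len N + 1) ≤ m`.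
* `DCP.successProb_le_one_holds` discharges `DCP.successProb_le_one`: over a unitary gate set
  the success probability `DCP.successProb C N d μ` (the `μ`-average of the Born probability of
  reading the shift `d` off the output of `C` on `inputState m N r d ρ`) is at most `1` whenever
  `len N + r * (len N + 1) ≤ m`. The Born probability of an event is a sub-sum of the squared
  output amplitudes (`QCircuit.probEvent_le_normSq`), the output `U_C |input(ρ)⟩` of a unitary
  circuit on the unit vector `inputState` is a unit vector (`normSq_inputState_holds`,
  `normSq_mulVec_of_mem_unitaryGroup`, `QCircuit.toMatrix_mem_unitaryGroup_holds`), and the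
  weights `μ ρ` of the probability mass function `μ` sum to `1`.

## Proof

Write `ℓ = len N`, `W = ℓ + r (ℓ + 1)` and `m = W + t`. The squared amplitude of a basis
label `s` is the product of the prefix indicator, the `r` squared register amplitudes and the
tail indicator, each depending on its own block of wires; splitting `Fin (W + t) → Bool` along
`Fin.appendEquiv` (twice) and the register block along `finProdFinEquiv` turns the sum into
`1 · ∏ₖ (∑_{c, y} ‖⟨c, y | ρ k⟩‖²) · 1` (`Fintype.prod_sum`). One register contributes `1`:
reading the `ℓ` data wires is the bijection `finFunctionFinEquiv : (Fin ℓ → Fin 2) ≃ Fin (2^ℓ)`,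
and every residue `x < N` occurs among the `ℓ`-bit words because `N < 2 ^ len N`
(`lt_two_pow_len`, by induction over the binary numerals `PosNum` behind
`Computability.encodeNat`); a bad register `|b, x⟩` has one amplitude `1`, a coset register
has the two amplitudes `1/√2` at `|0, x⟩` and `|1, (x + d) mod N⟩`.

## References

* O. Regev, *Quantum computation and lattice problems*, SIAM J. Comput. 33 (2004) 738–760:
  §1, p. 2 (the paragraph after Thm. 1.1: the input registers `|0, x⟩ + |1, (x + d) mod N⟩`)
  and Def. 2.1, p. 5 (each register is `(|0, x⟩ + |1, (x + d) mod N⟩)/√2` on `1 + ⌈log N⌉`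
  qubits, or a 'bad' register `|b, x⟩`). The statement file cites this as "§1, Def. 1.3"; in
  the journal numbering the formal definition is Def. 2.1.
* M. A. Nielsen, I. L. Chuang, *Quantum Computation and Quantum Information* (2010), §2.1.7
  (tensor products of unit vectors are unit vectors).
* M. A. Nielsen, I. L. Chuang, op. cit., 10th anniversary ed., CUP 2010
  (doi:10.1017/cbo9780511976667; first edition 2000, same section numbering): §2.2.3,
  Postulate 3, eqs. (2.92)–(2.95), pp. 84–85 (outcome probabilities
  `p(m) = ⟨ψ|M_m† M_m|ψ⟩`; "the completeness equation expresses the fact that probabilities sum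
  to one"); §2.2.5, eq. (2.103), p. 87 (measurement in an orthonormal basis,
  `p(m) = ⟨ψ|P_m|ψ⟩`); §2.1.6, eq. (2.36), p. 71 (unitary operators preserve inner products) —
  the sources of `successProb_le_one_holds`.
-/

open Computability

namespace Literature.Computability.Cryptography

namespace DCP

/-! ### The modulus fits in `len N` bits -/

/-- A positive binary numeral `p` is below `2 ^ (number of binary digits of p)`, the digits
being those written by `Computability.encodePosNum`. [folklore] -/
theorem lt_two_pow_length_encodePosNum :
    ∀ p : PosNum, (p : ℕ) < 2 ^ (encodePosNum p).length
  | PosNum.one => by simp [encodePosNum, PosNum.cast_one']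
  | PosNum.bit0 p => by
      have ih := lt_two_pow_length_encodePosNum p
      simp only [encodePosNum, List.length_cons, Nat.pow_succ, PosNum.cast_bit0]
      omega
  | PosNum.bit1 p => by
      have ih := lt_two_pow_length_encodePosNum p
      simp only [encodePosNum, List.length_cons, Nat.pow_succ, PosNum.cast_bit1]
      omega

/-- A binary numeral `n` is below `2 ^ |encodeNum n|`. [folklore] -/
theorem lt_two_pow_length_encodeNum : ∀ n : Num, (n : ℕ) < 2 ^ (encodeNum n).length
  | Num.zero => by simp [encodeNum, Num.cast_zero']
  | Num.pos p => by
      rw [Num.cast_pos]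
      exact lt_two_pow_length_encodePosNum p

/-- `N < 2 ^ len N`: every residue `x < N` fits in the `len N = |encodeNat N|` data wires of a
register (Regev's "`⌈log N⌉` qubits"). [folklore] -/
theorem lt_two_pow_len (N : ℕ) : N < 2 ^ len N := by
  have h := lt_two_pow_length_encodeNum (N : Num)
  rw [Num.to_of_nat] at h
  exact h

/-! ### Reading the wires of a split label -/

/-- Reading a wire below `a` of an `(a + b)`-wire label through its first block. [folklore] -/
theorem qbit_castAdd {a b : ℕ} (s : QReg (a + b)) {p : ℕ} (hp : p < a) :
    qbit (fun i => s (Fin.castAdd b i)) p = qbit s p := by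
  unfold qbit
  rw [dif_pos hp, dif_pos (Nat.lt_add_right b hp)]
  rfl

/-- Reading wire `a + p` of an `(a + b)`-wire label through its second block. [folklore] -/
theorem qbit_natAdd {a b : ℕ} (s : QReg (a + b)) (p : ℕ) :
    qbit (fun j => s (Fin.natAdd a j)) p = qbit s (a + p) := by
  unfold qbit
  by_cases hp : p < b
  · rw [dif_pos hp, dif_pos (Nat.add_lt_add_left hp a)]
    rfl
  · rw [dif_neg hp, dif_neg (by omega)]

/-- Reading a window below `a` of an `(a + b)`-wire label through its first block. [folklore] -/
theorem readNat_castAdd {a b : ℕ} (s : QReg (a + b)) {p ℓ : ℕ} (h : p + ℓ ≤ a) :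
    readNat (fun i => s (Fin.castAdd b i)) p ℓ = readNat s p ℓ := by
  unfold readNat
  refine Finset.sum_congr rfl fun t ht => ?_
  rw [qbit_castAdd s (by have := Finset.mem_range.1 ht; omega)]

/-- Reading a window of the second block of an `(a + b)`-wire label. [folklore] -/
theorem readNat_natAdd {a b : ℕ} (s : QReg (a + b)) (p ℓ : ℕ) :
    readNat (fun j => s (Fin.natAdd a j)) p ℓ = readNat s (a + p) ℓ := by
  unfold readNat
  refine Finset.sum_congr rfl fun t _ => ?_
  rw [qbit_natAdd, Nat.add_assoc]

/-! ### Elementary sums -/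

/-- `‖[P] · a‖² = [P] · ‖a‖²`. [folklore] -/
theorem norm_sq_ite {P : Prop} [Decidable P] (a : ℂ) :
    ‖(if P then a else 0)‖ ^ 2 = if P then ‖a‖ ^ 2 else 0 := by
  split_ifs <;> simp

/-- The indicator of one `n`-bit word sums to `1`. [folklore] -/
theorem sum_ite_funext {n : ℕ} (a : QReg n) :
    ∑ u : QReg n, (if ∀ i, u i = a i then (1 : ℝ) else 0) = 1 := by
  rw [Fintype.sum_eq_single a fun u hu => if_neg fun h => hu (funext h), if_pos fun _ => rfl]

/-- Tensor factorisation: a sum over `(a + b)`-wire labels of (a function of the first `a`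
wires) × (a function of the last `b` wires) is the product of the two sums
(`Fin.appendEquiv`). [folklore] -/
theorem sum_mul_castAdd_natAdd {a b : ℕ} (f : QReg a → ℝ) (g : QReg b → ℝ) :
    ∑ s : QReg (a + b), f (fun i => s (Fin.castAdd b i)) * g (fun j => s (Fin.natAdd a j)) =
      (∑ u, f u) * ∑ v, g v :=
  calc ∑ s : QReg (a + b), f (fun i => s (Fin.castAdd b i)) * g (fun j => s (Fin.natAdd a j))
      = ∑ p : QReg a × QReg b, f p.1 * g p.2 :=
        (Fintype.sum_equiv (Fin.appendEquiv a b) _ _ fun p => by simp).symm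
    _ = ∑ u, ∑ v, f u * g v := Fintype.sum_prod_type' fun u v => f u * g v
    _ = (∑ u, f u) * ∑ v, g v := (Fintype.sum_mul_sum f g).symm

/-! ### One register -/

/-- The squared amplitudes `‖⟨c, y | ρ⟩‖²` of one register state sum to `1` over the control
bit `c` and the `ℓ`-bit data `y < 2 ^ ℓ`, provided `N ≤ 2 ^ ℓ`: a bad register `|b, x⟩` has the
single amplitude `1` at `(b, x)`, a coset register the amplitudes `1/√2` at `(0, x)` and
`(1, (x + d) mod N)`. [Regev 2004, Def. 2.1] [cite: Regev2004, §2 Def. 2.1 (p. 5)] -/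
theorem sum_normSq_registerAmp {N ℓ : ℕ} (d : ℕ) (ρ : Register N) (hN : N ≤ 2 ^ ℓ) :
    ∑ c : Bool, ∑ y : Fin (2 ^ ℓ), ‖registerAmp N d ρ c y‖ ^ 2 = 1 := by
  have key : ∀ x : ℕ, x < N → ∀ a : ℝ,
      ∑ y : Fin (2 ^ ℓ), (if (y : ℕ) = x then a else 0) = a := fun x hx a => by
    rw [Fin.sum_univ_eq_sum_range (fun y => if y = x then a else 0), Finset.sum_ite_eq',
      if_pos (Finset.mem_range.2 (lt_of_lt_of_le hx hN))]
  rcases ρ with ⟨_ | b, x⟩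
  · -- coset register `(|0, x⟩ + |1, (x + d) mod N⟩)/√2`
    have hN0 : 0 < N := Nat.zero_lt_of_lt x.isLt
    have h2 : ‖((Real.sqrt 2 : ℂ))⁻¹‖ ^ 2 = 1 / 2 := by
      rw [norm_inv, Complex.norm_real, Real.norm_of_nonneg (Real.sqrt_nonneg _), inv_pow,
        Real.sq_sqrt zero_le_two, one_div]
    have hval : ∀ (c : Bool) (y : ℕ), ‖registerAmp N d (none, x) c y‖ ^ 2 =
        if y = (bif c then ((x : ℕ) + d) % N else (x : ℕ)) then 1 / 2 else 0 := fun c y => by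
      simp only [registerAmp, norm_sq_ite, h2]
      exact if_congr (by cases c <;> simp) rfl rfl
    have hc : ∀ c : Bool, ∑ y : Fin (2 ^ ℓ), ‖registerAmp N d (none, x) c y‖ ^ 2 = 1 / 2 := by
      intro c
      have hlt : (bif c then ((x : ℕ) + d) % N else (x : ℕ)) < N := by
        cases c
        · exact x.isLt
        · exact Nat.mod_lt _ hN0
      simp only [hval]
      exact key _ hlt _
    simp only [hc, Fintype.sum_bool]
    norm_num
  · -- bad register `|b, x⟩`
    have hval : ∀ (c : Bool) (y : ℕ), ‖registerAmp N d (some b, x) c y‖ ^ 2 =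
        if c = b ∧ y = (x : ℕ) then 1 else 0 := fun c y => by
      simp only [registerAmp, norm_sq_ite, norm_one, one_pow]
    simp only [hval]
    rw [Fintype.sum_eq_single b fun c hc => by simp [hc]]
    simp only [true_and]
    exact key x x.isLt 1

/-- One register block of `ℓ + 1` wires (control wire `0`, data wires `1 … ℓ` little-endian)
carries total squared amplitude `1` when `N ≤ 2 ^ ℓ`: the data wires are read through the
bijection `finFunctionFinEquiv : (Fin ℓ → Fin 2) ≃ Fin (2 ^ ℓ)`. [folklore] -/
theorem sum_register_block {N ℓ : ℕ} (d : ℕ) (ρ : Register N) (hN : N ≤ 2 ^ ℓ) :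
    ∑ z : QReg (ℓ + 1), ‖registerAmp N d ρ (z 0)
      (∑ t : Fin ℓ, if z t.succ then 2 ^ (t : ℕ) else 0)‖ ^ 2 = 1 := by
  have h2 : ∀ bb : Bool, ((finTwoEquiv.symm bb : Fin 2) : ℕ) = if bb then 1 else 0 := by
    intro bb
    cases bb <;> rfl
  have hB : ∀ y : QReg ℓ, ((finFunctionFinEquiv (finTwoEquiv.symm ∘ y) : Fin (2 ^ ℓ)) : ℕ) =
      ∑ t : Fin ℓ, if y t then 2 ^ (t : ℕ) else 0 := fun y => by
    rw [finFunctionFinEquiv_apply]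
    refine Finset.sum_congr rfl fun t _ => ?_
    rw [Function.comp_apply, h2]
    cases y t <;> simp
  calc ∑ z : QReg (ℓ + 1), ‖registerAmp N d ρ (z 0)
        (∑ t : Fin ℓ, if z t.succ then 2 ^ (t : ℕ) else 0)‖ ^ 2
      = ∑ p : Bool × QReg ℓ, ‖registerAmp N d ρ p.1
          (∑ t : Fin ℓ, if p.2 t then 2 ^ (t : ℕ) else 0)‖ ^ 2 :=
        (Fintype.sum_equiv (Fin.consEquiv fun _ : Fin (ℓ + 1) => Bool) _ _ fun p => by
          simp only [Fin.consEquiv_apply, Fin.cons_zero, Fin.cons_succ]).symm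
    _ = ∑ c : Bool, ∑ y : QReg ℓ, ‖registerAmp N d ρ c
          (∑ t : Fin ℓ, if y t then 2 ^ (t : ℕ) else 0)‖ ^ 2 :=
        Fintype.sum_prod_type' fun c (y : QReg ℓ) => ‖registerAmp N d ρ c
          (∑ t : Fin ℓ, if y t then 2 ^ (t : ℕ) else 0)‖ ^ 2
    _ = ∑ c : Bool, ∑ y : Fin (2 ^ ℓ), ‖registerAmp N d ρ c y‖ ^ 2 := by
        refine Fintype.sum_congr _ _ fun c => Fintype.sum_equiv
          (((Equiv.refl (Fin ℓ)).arrowCongr finTwoEquiv.symm).trans finFunctionFinEquiv)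
          _ _ fun y => ?_
        rw [Equiv.trans_apply]
        exact congrArg (fun n : ℕ => ‖registerAmp N d ρ c n‖ ^ 2) (hB y).symm
    _ = 1 := sum_normSq_registerAmp d ρ hN

/-! ### The register region and the prefix -/

/-- The `r` register blocks (register `k` on the wires `k (ℓ+1) … k (ℓ+1) + ℓ`) carry total
squared amplitude `1`: regrouping the wires register by register (`finProdFinEquiv`) turns the
sum of products into the product of the one-register sums (`Fintype.prod_sum`). [folklore] -/
theorem sum_registers {N r ℓ : ℕ} (d : ℕ) (ρ : Fin r → Register N) (hN : N ≤ 2 ^ ℓ) :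
    ∑ v : QReg (r * (ℓ + 1)), ∏ k : Fin r, ‖registerAmp N d (ρ k) (qbit v (k * (ℓ + 1)))
      (readNat v (k * (ℓ + 1) + 1) ℓ)‖ ^ 2 = 1 := by
  -- wire `j` of register `k` is wire `k * (ℓ + 1) + j = finProdFinEquiv (k, j)`
  have hq : ∀ (v : QReg (r * (ℓ + 1))) (k : Fin r) (j : Fin (ℓ + 1)),
      qbit v (k * (ℓ + 1) + j) = v (finProdFinEquiv (k, j)) := fun v k j => by
    have hkj : (k : ℕ) * (ℓ + 1) + j = (finProdFinEquiv (k, j) : ℕ) := by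
      rw [finProdFinEquiv_apply_val]; ring
    unfold qbit
    rw [dif_pos (hkj ▸ (finProdFinEquiv (k, j)).isLt)]
    exact congrArg v (Fin.ext hkj)
  have hctrl : ∀ (v : QReg (r * (ℓ + 1))) (k : Fin r),
      qbit v (k * (ℓ + 1)) = v (finProdFinEquiv (k, 0)) := fun v k => by
    simpa using hq v k 0
  have hdata : ∀ (v : QReg (r * (ℓ + 1))) (k : Fin r), readNat v (k * (ℓ + 1) + 1) ℓ =
      ∑ t : Fin ℓ, if v (finProdFinEquiv (k, t.succ)) then 2 ^ (t : ℕ) else 0 := fun v k => by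
    rw [readNat, Finset.sum_range]
    refine Finset.sum_congr rfl fun t _ => ?_
    rw [show (k : ℕ) * (ℓ + 1) + 1 + t = k * (ℓ + 1) + (t.succ : ℕ) by
      rw [Fin.val_succ]; omega, hq]
  have he : Function.Bijective fun (v : QReg (r * (ℓ + 1))) (k : Fin r) (j : Fin (ℓ + 1)) =>
      v (finProdFinEquiv (k, j)) :=
    Function.bijective_iff_has_inverse.2
      ⟨fun w i => w (finProdFinEquiv.symm i).1 (finProdFinEquiv.symm i).2,
        fun v => funext fun i => by
          show v (finProdFinEquiv ((finProdFinEquiv.symm i).1, (finProdFinEquiv.symm i).2)) = v i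
          rw [Prod.mk.eta, Equiv.apply_symm_apply],
        fun w => funext fun k => funext fun j => by simp⟩
  calc ∑ v : QReg (r * (ℓ + 1)), ∏ k : Fin r, ‖registerAmp N d (ρ k) (qbit v (k * (ℓ + 1)))
        (readNat v (k * (ℓ + 1) + 1) ℓ)‖ ^ 2
      = ∑ w : Fin r → QReg (ℓ + 1), ∏ k : Fin r, ‖registerAmp N d (ρ k) (w k 0)
          (∑ t : Fin ℓ, if w k t.succ then 2 ^ (t : ℕ) else 0)‖ ^ 2 :=
        Fintype.sum_bijective _ he _ _ fun v => by simp only [hctrl v, hdata v]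
    _ = ∏ k : Fin r, ∑ z : QReg (ℓ + 1), ‖registerAmp N d (ρ k) (z 0)
          (∑ t : Fin ℓ, if z t.succ then 2 ^ (t : ℕ) else 0)‖ ^ 2 :=
        (Fintype.prod_sum fun k (z : QReg (ℓ + 1)) => ‖registerAmp N d (ρ k) (z 0)
          (∑ t : Fin ℓ, if z t.succ then 2 ^ (t : ℕ) else 0)‖ ^ 2).symm
    _ = 1 := Finset.prod_eq_one fun k _ => sum_register_block d (ρ k) hN

/-- Prefix block plus register region: for every prescribed prefix word `pre`, the sum over the
`ℓ + r (ℓ+1)`-wire labels of `[prefix = pre] · ∏ₖ ‖register k amplitude‖²` is `1`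
(`N ≤ 2 ^ ℓ`). [folklore] -/
theorem sum_prefix_registers {N r ℓ : ℕ} (d : ℕ) (ρ : Fin r → Register N) (hN : N ≤ 2 ^ ℓ)
    (pre : Fin ℓ → Bool) :
    ∑ u : QReg (ℓ + r * (ℓ + 1)),
      (if ∀ t : Fin ℓ, qbit u t = pre t then (1 : ℝ) else 0) *
        ∏ k : Fin r, ‖registerAmp N d (ρ k) (qbit u (ℓ + k * (ℓ + 1)))
          (readNat u (ℓ + k * (ℓ + 1) + 1) ℓ)‖ ^ 2 = 1 := by
  set P : QReg ℓ → ℝ := fun w => if ∀ t : Fin ℓ, w t = pre t then 1 else 0 with hP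
  set R : QReg (r * (ℓ + 1)) → ℝ := fun v => ∏ k : Fin r,
    ‖registerAmp N d (ρ k) (qbit v (k * (ℓ + 1))) (readNat v (k * (ℓ + 1) + 1) ℓ)‖ ^ 2 with hR
  have h : ∀ u : QReg (ℓ + r * (ℓ + 1)),
      (if ∀ t : Fin ℓ, qbit u t = pre t then (1 : ℝ) else 0) *
        ∏ k : Fin r, ‖registerAmp N d (ρ k) (qbit u (ℓ + k * (ℓ + 1)))
          (readNat u (ℓ + k * (ℓ + 1) + 1) ℓ)‖ ^ 2 =
      P (fun i => u (Fin.castAdd (r * (ℓ + 1)) i)) * R (fun j => u (Fin.natAdd ℓ j)) := by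
    intro u
    simp only [hP, hR]
    congr 1
    · refine if_congr (forall_congr' fun t => ?_) rfl rfl
      unfold qbit
      rw [dif_pos (Nat.lt_add_right _ t.isLt)]
      exact Iff.rfl
    · exact Finset.prod_congr rfl fun k _ => by rw [qbit_natAdd, readNat_natAdd, ← Nat.add_assoc]
  have hPsum : ∑ w, P w = 1 := by
    rw [hP]
    exact sum_ite_funext pre
  have hRsum : ∑ v, R v = 1 := by
    rw [hR]
    exact sum_registers d ρ hN
  calc _ = ∑ u : QReg (ℓ + r * (ℓ + 1)),
          P (fun i => u (Fin.castAdd (r * (ℓ + 1)) i)) * R (fun j => u (Fin.natAdd ℓ j)) :=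
        Fintype.sum_congr _ _ h
    _ = (∑ w, P w) * ∑ v, R v := sum_mul_castAdd_natAdd P R
    _ = 1 := by rw [hPsum, hRsum, one_mul]

/-! ### The discharge -/

/-- Discharge of `normSq_inputState`: the DCP input state `inputState m N r d ρ` is a unit
vector whenever `len N + r * (len N + 1) ≤ m` (prefix `|encodeNat N⟩`, `r` register states each
of norm `1` on its own block of `len N + 1` wires, zero workspace; `N < 2 ^ len N` so that every
residue fits in the data wires). [Regev 2004, §1 p. 2 and Def. 2.1 p. 5; Nielsen–Chuang 2010,
§2.1.7] [cite: Regev2004, §1 (p. 2, after Thm. 1.1) and §2 Def. 2.1 (p. 5)] -/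
theorem normSq_inputState_holds : normSq_inputState := by
  intro m N r d ρ hm
  obtain ⟨t, rfl⟩ := Nat.exists_eq_add_of_le hm
  have hpos : ∀ k : Fin r, (k : ℕ) * (len N + 1) + (len N + 1) ≤ r * (len N + 1) := fun k => by
    rw [← Nat.succ_mul]
    exact Nat.mul_le_mul_right _ k.isLt
  set G : QReg t → ℝ := fun v => if ∀ j, v j = false then 1 else 0 with hG
  set F : QReg (len N + r * (len N + 1)) → ℝ := fun u =>
    (if ∀ t' : Fin (len N), qbit u t' = (encodeNat N).getD t' false then (1 : ℝ) else 0) *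
      ∏ k : Fin r, ‖registerAmp N d (ρ k) (qbit u (len N + k * (len N + 1)))
        (readNat u (len N + k * (len N + 1) + 1) (len N))‖ ^ 2 with hF
  have hA : ∀ s : QReg (len N + r * (len N + 1) + t),
      ‖inputState (len N + r * (len N + 1) + t) N r d ρ s‖ ^ 2 =
        F (fun i => s (Fin.castAdd t i)) *
          G (fun j => s (Fin.natAdd (len N + r * (len N + 1)) j)) := by
    intro s
    have h1 : (∀ t' : Fin (len N), qbit s t' = (encodeNat N).getD t' false) ↔
        ∀ t' : Fin (len N), qbit (fun i => s (Fin.castAdd t i)) t' =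
          (encodeNat N).getD t' false :=
      forall_congr' fun t' => by rw [qbit_castAdd s (by have := t'.isLt; omega)]
    have hq2 : ∀ k : Fin r, qbit s (len N + k * (len N + 1)) =
        qbit (fun i => s (Fin.castAdd t i)) (len N + k * (len N + 1)) :=
      fun k => (qbit_castAdd s (by have := hpos k; omega)).symm
    have hr2 : ∀ k : Fin r, readNat s (len N + k * (len N + 1) + 1) (len N) =
        readNat (fun i => s (Fin.castAdd t i)) (len N + k * (len N + 1) + 1) (len N) :=
      fun k => (readNat_castAdd s (by have := hpos k; omega)).symm
    have h3 : (∀ i : Fin (len N + r * (len N + 1) + t),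
        len N + r * (len N + 1) ≤ (i : ℕ) → s i = false) ↔
        ∀ j : Fin t, s (Fin.natAdd (len N + r * (len N + 1)) j) = false :=
      ⟨fun h j => h _ (Nat.le_add_right _ _), fun h i hi => by
        obtain ⟨j, rfl⟩ : ∃ j : Fin t, Fin.natAdd (len N + r * (len N + 1)) j = i :=
          ⟨⟨i - (len N + r * (len N + 1)), by omega⟩, Fin.ext (Nat.add_sub_of_le hi)⟩
        exact h j⟩
    simp only [hF, hG, inputState, norm_mul, norm_prod, mul_pow, ← Finset.prod_pow,
      norm_sq_ite, norm_one, one_pow, hq2, hr2]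
    rw [if_congr h1 rfl rfl, if_congr h3 rfl rfl]
  have hFsum : ∑ u, F u = 1 := by
    rw [hF]
    exact sum_prefix_registers d ρ (lt_two_pow_len N).le fun t' => (encodeNat N).getD t' false
  have hGsum : ∑ v, G v = 1 := by
    rw [hG]
    exact sum_ite_funext fun _ => false
  calc ∑ s, ‖inputState (len N + r * (len N + 1) + t) N r d ρ s‖ ^ 2
      = ∑ s : QReg (len N + r * (len N + 1) + t), F (fun i => s (Fin.castAdd t i)) *
          G (fun j => s (Fin.natAdd (len N + r * (len N + 1)) j)) := Fintype.sum_congr _ _ hA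
    _ = (∑ u, F u) * ∑ v, G v := sum_mul_castAdd_natAdd F G
    _ = 1 := by rw [hFsum, hGsum, one_mul]

end DCP

/-! ### Success probabilities are at most one -/

namespace QCircuit

variable {G : QGateSet} {n : ℕ}

/-- The Born probability of an event `E` is a sub-sum of the squared amplitudes of the output
state, hence at most its squared norm: `∑_{y ∈ E} |(U_C ψ)(y)|² ≤ ∑_y |(U_C ψ)(y)|²`.
(Nielsen–Chuang 2010, §2.2.3, eqs. (2.92)–(2.95), pp. 84–85: for a unit vector the outcome
probabilities of a measurement sum to one.) [folklore] -/
theorem probEvent_le_normSq (A : Language Bool) (C : QCircuit G n) (ψ : QReg n → ℂ)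
    (E : Set (QReg n)) : C.probEvent A ψ E ≤ normSq (C.runOn A ψ) := by
  classical
  unfold probEvent normSq
  exact Finset.sum_le_sum_of_subset_of_nonneg (Finset.filter_subset _ _)
    fun _ _ _ => by positivity

end QCircuit

namespace DCP

variable {G : QGateSet} {m : ℕ}

/-- **Discharge of `DCP.successProb_le_one`.** Over a unitary gate set, the success probability
of a circuit `C` on a DCP input whose register contents follow the law `μ` is at most `1` on
every register wide enough to hold the input (`len N + r * (len N + 1) ≤ m`): for each register
content `ρ` the input `inputState m N r d ρ` is a unit vector (`normSq_inputState_holds`) and so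
is the output `U_C |input(ρ)⟩`, unitaries preserving the norm
(`normSq_mulVec_of_mem_unitaryGroup` with `QCircuit.toMatrix_mem_unitaryGroup_holds`); hence the
Born probability of the success event, a sub-sum of the squared output amplitudes
(`QCircuit.probEvent_le_normSq`), is at most `1`, and `∑_ρ μ(ρ) · 1 = 1` (`PMF.tsum_coe`). This
is the statement that the outcome probabilities `p(m) = ⟨ψ|M_m† M_m|ψ⟩` of a measurement of a
unit vector sum to one by the completeness equation (Nielsen–Chuang 2010, §2.2.3, Postulate 3,
eqs. (2.92)–(2.95), pp. 84–85), here for the measurement of all wires in the computational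
basis (§2.2.5, eq. (2.103), p. 87) after the unitary evolution `U_C` (§2.1.6, eq. (2.36),
p. 71). [cite: NielsenChuang2010, §2.2.5 eq. (2.103) p. 87; §2.2.3 eqs. (2.92)–(2.95) pp. 84–85] -/
theorem successProb_le_one_holds : successProb_le_one (G := G) (m := m) := by
  intro hG C N d r μ hm
  unfold successProb
  have hone : ∀ ρ : Fin r → Register N,
      C.probEvent 0 (inputState m N r d ρ) (successEvent m N d) ≤ 1 := fun ρ => by
    refine (QCircuit.probEvent_le_normSq _ _ _ _).trans_eq ?_
    rw [QCircuit.runOn, normSq_mulVec_of_mem_unitaryGroup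
      (QCircuit.toMatrix_mem_unitaryGroup_holds hG 0 C)]
    exact normSq_inputState_holds m N r d ρ hm
  have hsum : ∑ ρ : Fin r → Register N, (μ ρ).toReal = 1 := by
    have h1 : ∑ ρ : Fin r → Register N, μ ρ = 1 := by
      have := μ.tsum_coe
      rwa [tsum_fintype] at this
    rw [← ENNReal.toReal_sum fun ρ _ => PMF.apply_ne_top μ ρ, h1, ENNReal.toReal_one]
  calc ∑ ρ : Fin r → Register N,
        (μ ρ).toReal * C.probEvent 0 (inputState m N r d ρ) (successEvent m N d)
      ≤ ∑ ρ : Fin r → Register N, (μ ρ).toReal * 1 :=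
        Finset.sum_le_sum fun ρ _ => mul_le_mul_of_nonneg_left (hone ρ) ENNReal.toReal_nonneg
    _ = 1 := by rw [← Finset.sum_mul, hsum, one_mul]

/-- Applied form of `successProb_le_one_holds` for the Clifford+T solvers of `HasSolution`-type
statements: success probabilities of a circuit over a unitary gate set are at most `1`.
[cite: NielsenChuang2010, §2.2.5 eq. (2.103) p. 87] -/
theorem successProb_le_one' (hG : G.IsUnitary) (C : QCircuit G m) (N d : ℕ) {r : ℕ}
    (μ : PMF (Fin r → Register N)) (hm : len N + r * (len N + 1) ≤ m) :
    successProb C N d μ ≤ 1 :=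
  successProb_le_one_holds hG C N d μ hm

/-- **Discharge of `HasSolution.mono`: monotonicity of the dihedral coset problem in the failure
parameter.** If `f ≤ f'` then every register distribution admissible for `f'` is admissible for
`f`: admissibility asks `1 - 1 / (log₂ N)^f ≤ Pr[register k failed]` for every `k`, and for `N ≥ 2`
(so `log₂ N ≥ 1`) the threshold `1 - 1 / (log₂ N)^f` is monotone in `f`
(`Real.rpow_le_rpow_of_exponent_le`). Hence a circuit family solving the problem for `f` — which
must succeed on the LARGER class of `f`-admissible inputs — solves it for `f'` with the same
ancilla count, register number and success exponent. Regev 2004, §1, remark after Def. 1.3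
("a solution for failure parameter `f` is also a solution for any `f' ≥ f`").
[cite: Regev2004, §1 remark after Def. 1.3] -/
theorem HasSolution.mono_holds : HasSolution.mono := by
  intro f f' hff' h
  obtain ⟨F, hF₁, hF₂, r, hr, c, hc⟩ := h
  refine ⟨F, hF₁, hF₂, r, hr, c, fun N hN => ?_⟩
  obtain ⟨h₁, h₂⟩ := hc N hN
  refine ⟨h₁, fun d hd μ hμ => h₂ d hd μ fun k => le_trans ?_ (hμ k)⟩
  have hN' : (1 : ℝ) < N := by exact_mod_cast hN
  have hlog : 1 ≤ Real.logb 2 (N : ℝ) := by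
    rw [Real.le_logb_iff_rpow_le one_lt_two (by positivity), Real.rpow_one]
    exact_mod_cast hN
  have hpow : Real.logb 2 (N : ℝ) ^ f ≤ Real.logb 2 (N : ℝ) ^ f' :=
    Real.rpow_le_rpow_of_exponent_le hlog hff'
  have hpos : 0 < Real.logb 2 (N : ℝ) ^ f := Real.rpow_pos_of_pos (by linarith) _
  have : 1 / Real.logb 2 (N : ℝ) ^ f' ≤ 1 / Real.logb 2 (N : ℝ) ^ f :=
    one_div_le_one_div_of_le hpos hpow
  linarith

end DCP

end Literature.Computability.Cryptography
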